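import Mathlib

/-!
# Zero-mode quartic of the toron valley: definitions and algebra
# (towards the BC5 rung `stub_rung_zeroModeLog4` of crux ⟨stmt-QuantumFields-24497⟩ `ToronTubeVolumeLaw`,
# LINE g15-B `ToronValleyVolume` of planner seat ym-idea-4; free-hands work of prover seat ym-dw-p1 g24)

The registered skeleton `ideators/ym-idea-4/bc/g15-B/ToronTubeVolumeLaw_birth.lean` posits the Gaussian-regularised
zero-mode partition function of the periodic `su(2)` block,
`Z_k(β) = ∫_{(ℝ³)^k} exp(−β Q_k(c) − Σ_μ ‖c_μ‖²/2) dc`, `Q_k(c) = Σ_{μ<ν} (‖c_μ‖²‖c_ν‖² − ⟪c_μ,c_ν⟫²) = Σ_{μ<ν} ‖c_μ × c_ν‖²`,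
and its BC5 plan-only rung `∃ A > 0, β³ Z₄(β)/log β → A` (ONE log: real log-canonical threshold with multiplicity 2).
This file restates the two skeleton-local definitions CHARACTER-IDENTICALLY in the skeleton namespace (so the rung can
be landed BY NAME) and records the algebra used by the proof: the pair discriminant `D(u,v) = ‖u‖²‖v‖² − ⟪u,v⟫²`, the
symmetric half-double-sum form of `Q_k`, permutation invariance, the last-column splitting
`Q₄(snoc x a) = Q₃(x) + Σ_μ D(x_μ, a)`, the coordinate (Lagrange) identities on `ℝ³`, and positivity / measurability /
integrability of the integrand.

HONEST LABEL: helper algebra for a plan-only BC5 rung of a DRAFT-by-design sub-route; no crux, rung of the ladder, leaf or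
summit statement is proved here; the Yang–Mills mass gap is NOT proved by this.
-/

noncomputable section

namespace Summit.QuantumFields.YangMills.Cruxes.ToronTubeVolumeLaw.Birth

open MeasureTheory

/-- The zero-mode quartic `Q_k(c) = Σ_{μ<ν} (‖c_μ‖²‖c_ν‖² − ⟪c_μ, c_ν⟫²) = Σ_{μ<ν} ‖c_μ × c_ν‖²`
(restated character-identically from the registered skeleton `bc/g15-B/ToronTubeVolumeLaw_birth.lean`). -/
def zeroModeQuartic (k : ℕ) (c : Fin k → EuclideanSpace ℝ (Fin 3)) : ℝ :=
  ∑ μ : Fin k, ∑ ν : Fin k, if μ < ν then (‖c μ‖ ^ 2 * ‖c ν‖ ^ 2 - (@inner ℝ _ _ (c μ) (c ν)) ^ 2) else 0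

/-- Gaussian-regularised zero-mode partition function `Zₖ(β) = ∫ exp(−β·Q_k(c) − Σ_μ ‖c_μ‖²/2) dc` over `(ℝ³)ᵏ`
(restated character-identically from the registered skeleton `bc/g15-B/ToronTubeVolumeLaw_birth.lean`). -/
def zeroModeZ (k : ℕ) (β : ℝ) : ℝ :=
  ∫ c : Fin k → EuclideanSpace ℝ (Fin 3), Real.exp (-β * zeroModeQuartic k c - (∑ μ : Fin k, ‖c μ‖ ^ 2) / 2)

end Summit.QuantumFields.YangMills.Cruxes.ToronTubeVolumeLaw.Birth

namespace Summit.QuantumFields.YangMills.Theorems.ToronValleyVolume.ZeroMode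

open MeasureTheory Real Finset
open Summit.QuantumFields.YangMills.Cruxes.ToronTubeVolumeLaw.Birth

/-! ## §1 The pair discriminant -/

/-- The pair discriminant `D(u,v) = ‖u‖²‖v‖² − ⟪u,v⟫²` (`= ‖u × v‖²` on `ℝ³`). -/
def pd (u v : EuclideanSpace ℝ (Fin 3)) : ℝ := ‖u‖ ^ 2 * ‖v‖ ^ 2 - (inner ℝ u v) ^ 2

/-- `D` is symmetric. -/
theorem pd_comm (u v : EuclideanSpace ℝ (Fin 3)) : pd u v = pd v u := by
  unfold pd; rw [real_inner_comm u v]; ring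

/-- `D(u,u) = 0`. -/
theorem pd_self (u : EuclideanSpace ℝ (Fin 3)) : pd u u = 0 := by
  unfold pd; rw [real_inner_self_eq_norm_sq]; ring

/-- `D ≥ 0` (Cauchy–Schwarz). -/
theorem pd_nonneg (u v : EuclideanSpace ℝ (Fin 3)) : 0 ≤ pd u v := by
  unfold pd
  have h := abs_real_inner_le_norm u v
  have h0 : 0 ≤ ‖u‖ * ‖v‖ := by positivity
  have h1 : (inner ℝ u v) ^ 2 ≤ (‖u‖ * ‖v‖) ^ 2 := by
    rw [← sq_abs]; exact pow_le_pow_left₀ (abs_nonneg _) h 2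
  nlinarith [h1]

/-- `D` is invariant under a linear isometry applied to both arguments. -/
theorem pd_map (R : EuclideanSpace ℝ (Fin 3) ≃ₗᵢ[ℝ] EuclideanSpace ℝ (Fin 3)) (u v : EuclideanSpace ℝ (Fin 3)) :
    pd (R u) (R v) = pd u v := by
  unfold pd; rw [R.norm_map, R.norm_map, R.inner_map_map]

/-! ## §2 The quartic as a symmetric half double sum -/

/-- `Q_k(c) = ½ Σ_μ Σ_ν D(c_μ, c_ν)`. -/
theorem quartic_eq_half_sum (k : ℕ) (c : Fin k → EuclideanSpace ℝ (Fin 3)) :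
    zeroModeQuartic k c = (1 / 2) * ∑ μ, ∑ ν, pd (c μ) (c ν) := by
  unfold zeroModeQuartic
  -- split the double sum of `pd` into `μ < ν`, `μ = ν`, `ν < μ`
  have hsplit : ∀ μ ν : Fin k, pd (c μ) (c ν) =
      (if μ < ν then pd (c μ) (c ν) else 0) + (if ν < μ then pd (c μ) (c ν) else 0) := by
    intro μ ν
    rcases lt_trichotomy μ ν with h | h | h
    · rw [if_pos h, if_neg (not_lt.2 h.le), add_zero]
    · subst h; rw [if_neg (lt_irrefl _), pd_self, add_zero]
    · rw [if_neg (not_lt.2 h.le), if_pos h, zero_add]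
  have hswap : ∑ μ, ∑ ν, (if ν < μ then pd (c μ) (c ν) else 0) =
      ∑ μ, ∑ ν, (if μ < ν then pd (c μ) (c ν) else 0) := by
    rw [Finset.sum_comm]
    refine Finset.sum_congr rfl fun μ _ => Finset.sum_congr rfl fun ν _ => ?_
    by_cases h : μ < ν
    · rw [if_pos h, if_pos h, pd_comm]
    · rw [if_neg h, if_neg h]
  have hpd : ∀ μ ν : Fin k, (if μ < ν then (‖c μ‖ ^ 2 * ‖c ν‖ ^ 2 - (@inner ℝ _ _ (c μ) (c ν)) ^ 2) else 0) =
      (if μ < ν then pd (c μ) (c ν) else 0) := fun μ ν => by rfl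
  simp_rw [hpd]
  conv_rhs => rw [show (∑ μ, ∑ ν, pd (c μ) (c ν)) =
      ∑ μ, ∑ ν, ((if μ < ν then pd (c μ) (c ν) else 0) + (if ν < μ then pd (c μ) (c ν) else 0)) from
    Finset.sum_congr rfl fun μ _ => Finset.sum_congr rfl fun ν _ => hsplit μ ν]
  simp_rw [Finset.sum_add_distrib]
  rw [hswap]; ring

/-- `Q_k ≥ 0`. -/
theorem quartic_nonneg (k : ℕ) (c : Fin k → EuclideanSpace ℝ (Fin 3)) : 0 ≤ zeroModeQuartic k c := by
  rw [quartic_eq_half_sum]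
  exact mul_nonneg (by norm_num) (sum_nonneg fun μ _ => sum_nonneg fun ν _ => pd_nonneg _ _)

/-- Permutation invariance: `Q_k(c ∘ σ) = Q_k(c)`. -/
theorem quartic_perm (k : ℕ) (σ : Equiv.Perm (Fin k)) (c : Fin k → EuclideanSpace ℝ (Fin 3)) :
    zeroModeQuartic k (c ∘ σ) = zeroModeQuartic k c := by
  rw [quartic_eq_half_sum, quartic_eq_half_sum]
  congr 1
  calc ∑ μ, ∑ ν, pd ((c ∘ σ) μ) ((c ∘ σ) ν) = ∑ μ, ∑ ν, pd (c (σ μ)) (c ν) := by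
        refine Finset.sum_congr rfl fun μ _ => ?_
        exact Equiv.sum_comp σ (fun ν => pd (c (σ μ)) (c ν))
    _ = ∑ μ, ∑ ν, pd (c μ) (c ν) := Equiv.sum_comp σ (fun μ => ∑ ν, pd (c μ) (c ν))

/-- Invariance under a linear isometry applied to every column. -/
theorem quartic_map (k : ℕ) (R : EuclideanSpace ℝ (Fin 3) ≃ₗᵢ[ℝ] EuclideanSpace ℝ (Fin 3))
    (c : Fin k → EuclideanSpace ℝ (Fin 3)) :
    zeroModeQuartic k (fun μ => R (c μ)) = zeroModeQuartic k c := by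
  rw [quartic_eq_half_sum, quartic_eq_half_sum]; simp_rw [pd_map]

/-- Splitting off the last column: `Q₄(snoc x a) = Q₃(x) + Σ_μ D(x_μ, a)`. -/
theorem quartic_four_snoc (x : Fin 3 → EuclideanSpace ℝ (Fin 3)) (a : EuclideanSpace ℝ (Fin 3)) :
    zeroModeQuartic 4 (Fin.snoc x a) = zeroModeQuartic 3 x + ∑ μ, pd (x μ) a := by
  rw [quartic_eq_half_sum, quartic_eq_half_sum]
  simp_rw [Fin.sum_univ_castSucc (n := 3), Fin.snoc_castSucc, Fin.snoc_last, pd_self]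
  have h : ∀ μ : Fin 3, pd a (x μ) = pd (x μ) a := fun μ => pd_comm _ _
  simp_rw [h, Finset.sum_add_distrib]
  ring

/-- Norm-sum splitting: `Σ_{μ<4} ‖(snoc x a)_μ‖² = Σ_{μ<3} ‖x_μ‖² + ‖a‖²`. -/
theorem normSq_four_snoc (x : Fin 3 → EuclideanSpace ℝ (Fin 3)) (a : EuclideanSpace ℝ (Fin 3)) :
    ∑ μ : Fin 4, ‖(Fin.snoc x a : Fin 4 → EuclideanSpace ℝ (Fin 3)) μ‖ ^ 2 = (∑ μ : Fin 3, ‖x μ‖ ^ 2) + ‖a‖ ^ 2 := by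
  rw [Fin.sum_univ_castSucc (n := 3)]
  simp_rw [Fin.snoc_castSucc, Fin.snoc_last]

/-! ## §3 Coordinates on `ℝ³` -/

/-- Planar (coordinates `0,1`) squared length. -/
def plSq (u : EuclideanSpace ℝ (Fin 3)) : ℝ := u 0 ^ 2 + u 1 ^ 2

/-- The mixed ("cross") part of the discriminant: `(v₂u₀ − u₂v₀)² + (v₂u₁ − u₂v₁)²`. -/
def cr (u v : EuclideanSpace ℝ (Fin 3)) : ℝ := (v 2 * u 0 - u 2 * v 0) ^ 2 + (v 2 * u 1 - u 2 * v 1) ^ 2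

/-- `plSq ≥ 0`. -/
theorem plSq_nonneg (u : EuclideanSpace ℝ (Fin 3)) : 0 ≤ plSq u := by unfold plSq; positivity

/-- `cr ≥ 0`. -/
theorem cr_nonneg (u v : EuclideanSpace ℝ (Fin 3)) : 0 ≤ cr u v := by unfold cr; positivity

/-- `cr` is symmetric. -/
theorem cr_comm (u v : EuclideanSpace ℝ (Fin 3)) : cr u v = cr v u := by unfold cr; ring

/-- `cr(u,u) = 0`. -/
theorem cr_self (u : EuclideanSpace ℝ (Fin 3)) : cr u u = 0 := by unfold cr; ring

/-- LAGRANGE IDENTITY on `ℝ³`: `D(u,v) = (u₀v₁ − u₁v₀)² + cr(u,v)`. -/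
theorem pd_eq_coord (u v : EuclideanSpace ℝ (Fin 3)) : pd u v = (u 0 * v 1 - u 1 * v 0) ^ 2 + cr u v := by
  have hi : inner ℝ u v = u 0 * v 0 + u 1 * v 1 + u 2 * v 2 := by
    rw [PiLp.inner_apply, Fin.sum_univ_three]; simp [mul_comm]
  unfold pd cr
  rw [EuclideanSpace.real_norm_sq_eq u, EuclideanSpace.real_norm_sq_eq v, Fin.sum_univ_three, Fin.sum_univ_three, hi]
  ring

/-- Lower bound: `cr ≤ D`. -/
theorem cr_le_pd (u v : EuclideanSpace ℝ (Fin 3)) : cr u v ≤ pd u v := by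
  rw [pd_eq_coord]; nlinarith [sq_nonneg (u 0 * v 1 - u 1 * v 0)]

/-- Upper bound: `D(u,v) ≤ plSq(u)·plSq(v) + cr(u,v)` (planar Cauchy–Schwarz). -/
theorem pd_le_plSq_mul_add_cr (u v : EuclideanSpace ℝ (Fin 3)) : pd u v ≤ plSq u * plSq v + cr u v := by
  rw [pd_eq_coord]; unfold plSq
  nlinarith [sq_nonneg (u 0 * v 0 + u 1 * v 1)]

/-- `‖u‖² = plSq u + u₂²`. -/
theorem normSq_eq_plSq_add (u : EuclideanSpace ℝ (Fin 3)) : ‖u‖ ^ 2 = plSq u + u 2 ^ 2 := by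
  rw [EuclideanSpace.real_norm_sq_eq, Fin.sum_univ_three]; unfold plSq; ring

/-- The third basis vector `e₃`. -/
def e3 : EuclideanSpace ℝ (Fin 3) := EuclideanSpace.single 2 1

/-- `‖e₃‖ = 1`. -/
theorem norm_e3 : ‖e3‖ = 1 := by
  unfold e3; rw [PiLp.norm_single]; simp

/-- `D(u, r·e₃) = r² · plSq(u)`. -/
theorem pd_smul_e3 (u : EuclideanSpace ℝ (Fin 3)) (r : ℝ) : pd u (r • e3) = r ^ 2 * plSq u := by
  unfold pd e3 plSq
  rw [norm_smul, PiLp.norm_single, inner_smul_right, EuclideanSpace.inner_single_right,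
    EuclideanSpace.real_norm_sq_eq u, Fin.sum_univ_three]
  simp only [Real.norm_eq_abs, norm_one, mul_one, one_mul, conj_trivial]
  rw [mul_pow, sq_abs]; ring

/-! ## §4 The integrand: positivity, Gaussian domination, integrability -/

/-- The integrand `exp(−β Q_k(c) − Σ_μ ‖c_μ‖²/2)` of `Z_k(β)`. -/
def zmI (k : ℕ) (β : ℝ) (c : Fin k → EuclideanSpace ℝ (Fin 3)) : ℝ :=
  Real.exp (-β * zeroModeQuartic k c - (∑ μ, ‖c μ‖ ^ 2) / 2)

/-- `Z_k(β)` is the integral of `zmI`. -/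
theorem zeroModeZ_eq_integral (k : ℕ) (β : ℝ) :
    zeroModeZ k β = ∫ c : Fin k → EuclideanSpace ℝ (Fin 3), zmI k β c := rfl

/-- The integrand is positive. -/
theorem zmI_pos (k : ℕ) (β : ℝ) (c : Fin k → EuclideanSpace ℝ (Fin 3)) : 0 < zmI k β c := Real.exp_pos _

/-- The Gaussian product weight `Π_μ exp(−‖c_μ‖²/2)`. -/
def gaussW (k : ℕ) (c : Fin k → EuclideanSpace ℝ (Fin 3)) : ℝ := ∏ μ, Real.exp (-‖c μ‖ ^ 2 / 2)

/-- The Gaussian weight as a single exponential. -/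
theorem gaussW_eq_exp (k : ℕ) (c : Fin k → EuclideanSpace ℝ (Fin 3)) :
    gaussW k c = Real.exp (-(∑ μ, ‖c μ‖ ^ 2) / 2) := by
  unfold gaussW; rw [← Real.exp_sum]; congr 1
  rw [neg_div, Finset.sum_div, ← Finset.sum_neg_distrib]
  exact Finset.sum_congr rfl fun μ _ => by ring

/-- The Gaussian weight is positive. -/
theorem gaussW_pos (k : ℕ) (c : Fin k → EuclideanSpace ℝ (Fin 3)) : 0 < gaussW k c := by
  rw [gaussW_eq_exp]; exact Real.exp_pos _

/-- For `β ≥ 0` the integrand is dominated by the Gaussian weight. -/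
theorem zmI_le_gaussW (k : ℕ) {β : ℝ} (hβ : 0 ≤ β) (c : Fin k → EuclideanSpace ℝ (Fin 3)) :
    zmI k β c ≤ gaussW k c := by
  rw [gaussW_eq_exp]; unfold zmI
  refine Real.exp_le_exp.2 ?_
  have := mul_nonneg hβ (quartic_nonneg k c)
  rw [neg_div]; linarith

/-- The Gaussian `exp(−‖x‖²/2)` is integrable on `ℝ³`. -/
theorem integrable_exp_neg_normSq_half :
    Integrable fun x : EuclideanSpace ℝ (Fin 3) => Real.exp (-‖x‖ ^ 2 / 2) := by
  have h := GaussianFourier.integrable_cexp_neg_mul_sq_norm_add (V := EuclideanSpace ℝ (Fin 3)) (b := 1 / 2)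
    (by norm_num) 0 0
  simp only [zero_mul, add_zero] at h
  refine h.norm.congr (Filter.Eventually.of_forall fun x => ?_)
  simp only [Complex.norm_exp]
  congr 1
  rw [show (-(1 / 2 : ℂ) * ((‖x‖ : ℂ)) ^ 2) = (((-‖x‖ ^ 2 / 2 : ℝ)) : ℂ) by push_cast; ring]
  exact Complex.ofReal_re _

/-- The Gaussian product weight is integrable on `(ℝ³)ᵏ`. -/
theorem integrable_gaussW (k : ℕ) : Integrable (gaussW k) := by
  have h := Integrable.fintype_prod (ι := Fin k) (μ := fun _ => (volume : Measure (EuclideanSpace ℝ (Fin 3))))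
    (f := fun _ x => Real.exp (-‖x‖ ^ 2 / 2)) (fun _ => integrable_exp_neg_normSq_half)
  exact h

/-- `Q_k` is continuous. -/
theorem continuous_quartic (k : ℕ) : Continuous (zeroModeQuartic k) := by
  have h : zeroModeQuartic k = fun c => (1 / 2) * ∑ μ, ∑ ν, pd (c μ) (c ν) := funext (quartic_eq_half_sum k)
  rw [h]; unfold pd
  fun_prop

/-- The integrand is continuous. -/
theorem continuous_zmI (k : ℕ) (β : ℝ) : Continuous (zmI k β) := by
  unfold zmI
  have := continuous_quartic k
  fun_prop

/-- The integrand is measurable. -/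
theorem measurable_zmI (k : ℕ) (β : ℝ) : Measurable (zmI k β) := (continuous_zmI k β).measurable

/-- The integrand is integrable for `β ≥ 0`. -/
theorem integrable_zmI (k : ℕ) {β : ℝ} (hβ : 0 ≤ β) : Integrable (zmI k β) := by
  refine (integrable_gaussW k).mono' (continuous_zmI k β).aestronglyMeasurable (Filter.Eventually.of_forall fun c => ?_)
  rw [Real.norm_eq_abs, abs_of_pos (zmI_pos k β c)]
  exact zmI_le_gaussW k hβ c

/-- `Z_k(β)` as a lower Lebesgue integral (`β ≥ 0`). -/
theorem ofReal_zeroModeZ (k : ℕ) {β : ℝ} (hβ : 0 ≤ β) :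
    ENNReal.ofReal (zeroModeZ k β) = ∫⁻ c : Fin k → EuclideanSpace ℝ (Fin 3), ENNReal.ofReal (zmI k β c) := by
  rw [zeroModeZ_eq_integral]
  exact ofReal_integral_eq_lintegral_ofReal (integrable_zmI k hβ) (Filter.Eventually.of_forall fun c => (zmI_pos k β c).le)

/-- `Z_k(β) ≥ 0`. -/
theorem zeroModeZ_nonneg (k : ℕ) (β : ℝ) : 0 ≤ zeroModeZ k β := by
  rw [zeroModeZ_eq_integral]; exact integral_nonneg fun c => (zmI_pos k β c).le

/-- `Z_k(β)` as the real part of the lower integral of the integrand (`β ≥ 0`). -/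
theorem zeroModeZ_eq_toReal (k : ℕ) {β : ℝ} (hβ : 0 ≤ β) :
    zeroModeZ k β = (∫⁻ c : Fin k → EuclideanSpace ℝ (Fin 3), ENNReal.ofReal (zmI k β c)).toReal := by
  rw [← ofReal_zeroModeZ k hβ, ENNReal.toReal_ofReal (zeroModeZ_nonneg k β)]

/-- The lower integral of the integrand is finite (`β ≥ 0`). -/
theorem lintegral_zmI_lt_top (k : ℕ) {β : ℝ} (hβ : 0 ≤ β) :
    ∫⁻ c : Fin k → EuclideanSpace ℝ (Fin 3), ENNReal.ofReal (zmI k β c) < ⊤ := by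
  rw [← ofReal_zeroModeZ k hβ]; exact ENNReal.ofReal_lt_top

/-- The integrand with the last column split off. -/
theorem zmI_four_snoc (β : ℝ) (x : Fin 3 → EuclideanSpace ℝ (Fin 3)) (a : EuclideanSpace ℝ (Fin 3)) :
    zmI 4 β (Fin.snoc x a) =
      Real.exp (-β * (zeroModeQuartic 3 x + ∑ μ, pd (x μ) a) - ((∑ μ, ‖x μ‖ ^ 2) + ‖a‖ ^ 2) / 2) := by
  unfold zmI; rw [quartic_four_snoc, normSq_four_snoc]

/-- Permutation invariance of the integrand. -/
theorem zmI_perm (k : ℕ) (β : ℝ) (σ : Equiv.Perm (Fin k)) (c : Fin k → EuclideanSpace ℝ (Fin 3)) :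
    zmI k β (c ∘ σ) = zmI k β c := by
  unfold zmI; rw [quartic_perm]
  congr 2
  exact congrArg (· / (2:ℝ)) (Equiv.sum_comp σ (fun μ => ‖c μ‖ ^ 2))

/-- Isometry invariance of the integrand. -/
theorem zmI_map (k : ℕ) (β : ℝ) (R : EuclideanSpace ℝ (Fin 3) ≃ₗᵢ[ℝ] EuclideanSpace ℝ (Fin 3))
    (c : Fin k → EuclideanSpace ℝ (Fin 3)) : zmI k β (fun μ => R (c μ)) = zmI k β c := by
  unfold zmI; rw [quartic_map]; simp_rw [R.norm_map]

end Summit.QuantumFields.YangMills.Theorems.ToronValleyVolume.ZeroMode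

end
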